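import Summits.FinalStateConjecture.FinalStateConjecture.Theorems.PhotonSphereChannelsKerrDevDefs
import Summits.FinalStateConjecture.FinalStateConjecture.Theorems.PhotonSphereChannelsChannelsResolveTameDevelopmentsRTrappedSetTimeSeparation
import Literature.Geometry.Lorentzian.FutureNullCompleteness
import Literature.Geometry.Lorentzian.CausalityPushUp
import HarnessLib

/-!
# Route PhotonSphereChannels · crux `ChannelsResolveTameDevelopmentsR` (K2R, stmt-FinalStateConjecture-14075), line
# `kerr-isolation-dichotomy` — late observers exist: every outer point lies on a continuous future-escaping outer path

Stubs S4/S5/S6 of the line (`stub_noEternallyStrangeEnd`, `stub_hullConnectedness`,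
`stub_exhaustionFromKerrAsymptotics`, skeleton `Cruxes/ChannelsResolveTameDevelopmentsR/Lines/kerr_isolation_dichotomy.lean`)
all quantify over CONTINUOUS FUTURE-ESCAPING OUTER PATHS `γ : ℝ → 𝒟` (`TameHull.IsFutureEscapingPath`: every `γ s` is
an outer point, and `γ` eventually leaves `J⁻(K)` for every compact `K`), and gap (4) of S6 is the causal bookkeeping
"every late outer point lies on a continuous future-escaping outer path". This file proves that bookkeeping fact for
EVERY vacuum Cauchy development (no maximality, no `DevHyp`): registered sub-goal `stub_exists_futureEscapingPath` of
`stub_exhaustionFromKerrAsymptotics` (S6) — for every `q ∈ outerRegion 𝒟` there is a continuous `γ : ℝ → 𝒟` with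
`IsFutureEscapingPath 𝒟 γ` and `γ 0 = q`. In particular the antecedents of S4–S6 are never vacuous on a development
with a nonempty outer region.

## Proof

`q` is outer: `q ∈ J⁺(ι X)` and `q ≪ γ₀ t₁` for a normalised future null ray `γ₀` from `ι X` with affine domain
`dom ∋ 0` unbounded above and some `t₁ ∈ dom`, `t₁ ≥ 0`.
* §2 the ray: `[0, ∞) ⊆ dom`; the null future-directed initial velocity propagates along the geodesic
  (`IsGeodesicOn.isNull_and_isFutureDirected_velocity`), so `γ₀` is a future causal curve and `γ₀ t ≤ γ₀ t'` for
  `0 ≤ t ≤ t'`, `γ₀ t ∈ J⁺(ι X)`; and the ray ESCAPES: for compact `K` the set `J⁻(K) ∩ J⁺(ι X)` is compact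
  (`TrappedSet.isCompact_causalPast_inter_causalFuture_range_of_isCompact`, Hawking–Ellis Prop. 6.6.6) and a null
  geodesic ray of the globally hyperbolic development is not imprisoned in it
  (`Spacetime.exists_forall_notMem_of_isGeodesicOn_of_isNull`), so `γ₀ s ∉ J⁻(K)` for all large `s`.
* §3 the chain: with a compact exhaustion `K₀ ⊆ K₁ ⊆ ⋯` of the development, points `p₀ = q ≪ p₁ ≪ p₂ ≪ ⋯` with
  `pₖ ≪ γ₀(t₁ + mₖ)` for some `mₖ : ℕ` and `pₖ₊₁ ∉ J⁻(Kₖ₊₁)`: given `pₖ ≪ γ₀(t₁ + m)`, push the relation up the ray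
  (`x ≪ y ≤ z ⇒ x ≪ z`, O'Neill Cor. 14.1) to an index `m₁ ≥ m` with `γ₀(t₁ + m₁) ∉ J⁻(Kₖ₊₁)`; the open set
  `I⁺(pₖ) ∖ J⁻(Kₖ₊₁)` (`J⁻` of a compact set is closed in a globally hyperbolic spacetime) contains `γ₀(t₁ + m₁)`, a point
  of the closure of `I⁻(γ₀(t₁ + m₁ + 1))` (`J⁺ ⊆ closure I⁺`, O'Neill Lemma 14.6), hence meets it in a point `pₖ₊₁`.
* §1 threading (any time-oriented Lorentzian manifold): the future timelike segments `pₖ → pₖ₊₁`, affinely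
  reparametrised to `[k, k + 1]` and preceded by the constant `q` on `(-∞, 0]`, glue to a continuous `γ` with
  `γ s ∈ {p_⌊s⌋} ∪ I⁺(p_⌊s⌋)` and `γ s ≪ p_{⌊s⌋+1}` for `s ≥ 0` (`exists_continuous_of_chronologicalChain`).
* §4 assembly: `γ s` is outer (`J⁺(ι X)` is closed under `≪`-successors, `J⁺J⁺ = J⁺`; and
  `γ s ≪ p_{⌊s⌋+1} ≪ γ₀(t₁ + m)`), and escaping (for compact `K ⊆ K_N` and `s ≥ N + 1`: `γ s ∈ J⁻(K)` would put
  `p_⌊s⌋ ∈ J⁻(K) ⊆ J⁻(K_⌊s⌋)`).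

No definitions, no named facts; everything is proved over the Literature causality library.

## References

* B. O'Neill, *Semi-Riemannian geometry with applications to relativity*, Academic Press 1983, Ch. 14, Cor. 14.1
  (p. 402), Lemma 14.3 (p. 403), Lemma 14.6 (p. 404), Lemma 14.13 (p. 407), Lemma 14.22 (p. 412), Cor. 14.39,
  Lemma 14.40 (p. 423). [ONeillSemiRiemannian1983]
* S. W. Hawking, G. F. R. Ellis, *The large scale structure of space-time*, CUP 1973, §6.4 Prop. 6.4.7, §6.6
  Prop. 6.6.6. [HawkingEllis1973CUP]
-/

noncomputable section

-- the operator-norm instance on `E4 →L[ℝ] E4 →L[ℝ] ℝ` needs one more level of pending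
-- instance problems than the default (as in `PhotonSphereChannelsKerrDevDefs.lean`)
set_option maxSynthPendingDepth 3
-- every `Summit.FinalStateConjecture.FinalStateConjecture.…` name repeats the summit = sub-problem segment (D-0017 layout)
set_option linter.dupNamespace false

open Set Filter Function TopologicalSpace Manifold Bundle
open scoped Topology Manifold ContDiff ENNReal NNReal


namespace Summit.FinalStateConjecture.FinalStateConjecture.Theorems

open Literature.Geometry.Lorentzian
open Summit.FinalStateConjecture.FinalStateConjecture.Theorems.TameHull

/-! ### §1 Threading a chronological chain by one continuous path (any time-oriented Lorentzian manifold) -/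

section Chain

variable {E : Type*} [NormedAddCommGroup E] [NormedSpace ℝ E] {H : Type*} [TopologicalSpace H]
  {I : ModelWithCorners ℝ E H} {n : ℕ∞ω} {M : Type*} [TopologicalSpace M] [ChartedSpace H M]
  [IsManifold I ∞ M] {g : LorentzianMetric I n M} {τ : TimeOrientation g}

/-- **Threading a chronological chain.** If `p₀ ≪ p₁ ≪ p₂ ≪ ⋯` (each `pₖ₊₁ ∈ I⁺(pₖ)`), then there is a CONTINUOUS
path `γ : ℝ → M`, constant `= p₀` on `(-∞, 0]`, which on `[k, k + 1]` runs along a future timelike segment from `pₖ`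
to `pₖ₊₁`: for `s ≥ 0`, `γ s` is `p_⌊s⌋` or lies in `I⁺(p_⌊s⌋)`, and `p_{⌊s⌋+1} ∈ I⁺(γ s)`. (The segments are the
witnesses of `≪`, affinely reparametrised; continuity is glued interval by interval — corners are allowed, the path is
not claimed to be timelike.) O'Neill 1983, Ch. 14, pp. 402–403 (the relation `≪` and its witnessing timelike
segments). [cite: ONeillSemiRiemannian1983, Ch. 14, pp. 402–403] -/
theorem exists_continuous_of_chronologicalChain {p : ℕ → M}
    (h : ∀ k, p (k + 1) ∈ g.chronologicalFuture τ {p k}) :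
    ∃ γ : ℝ → M, Continuous γ ∧ (∀ s ≤ (0 : ℝ), γ s = p 0) ∧
      ∀ s : ℝ, 0 ≤ s → (γ s = p ⌊s⌋₊ ∨ γ s ∈ g.chronologicalFuture τ {p ⌊s⌋₊}) ∧
        p (⌊s⌋₊ + 1) ∈ g.chronologicalFuture τ {γ s} := by
  classical
  have h' : ∀ k, ∃ (σ : ℝ → M) (a b : ℝ), a < b ∧ g.IsFutureTimelikeCurveOn τ σ (Icc a b) ∧
      σ a = p k ∧ σ b = p (k + 1) := fun k ↦ by
    obtain ⟨p', hp', σ, a, b, hab, hσ, hσa, hσb⟩ := h k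
    exact ⟨σ, a, b, hab, hσ, hσa.trans (mem_singleton_iff.1 hp'), hσb⟩
  choose σ a b hab hσ hσa hσb using h'
  -- segment `k`, affinely reparametrised by `[k, k + 1]`
  set φ : ℕ → ℝ → ℝ := fun k s ↦ a k + (s - k) * (b k - a k) with hφ
  set γ : ℝ → M := fun s ↦ if s ≤ 0 then p 0 else σ ⌊s⌋₊ (φ ⌊s⌋₊ s) with hγ
  have hφa : ∀ k : ℕ, φ k k = a k := fun k ↦ by simp [hφ]
  have hφb : ∀ k : ℕ, φ k (k + 1) = b k := fun k ↦ by simp only [hφ]; ring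
  have hφmem : ∀ (k : ℕ) (s : ℝ), (k : ℝ) ≤ s → s ≤ k + 1 → φ k s ∈ Icc (a k) (b k) := by
    intro k s hks hsk
    have hba : 0 < b k - a k := sub_pos.2 (hab k)
    have h1 : 0 ≤ (s - k) * (b k - a k) := mul_nonneg (sub_nonneg.2 hks) hba.le
    have h2 : (s - k) * (b k - a k) ≤ b k - a k := mul_le_of_le_one_left hba.le (by linarith)
    exact ⟨by simp only [hφ]; linarith, by simp only [hφ]; linarith⟩
  have hφlt : ∀ (k : ℕ) (s : ℝ), s < k + 1 → φ k s < b k := by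
    intro k s hsk
    have h2 : (s - k) * (b k - a k) < b k - a k := mul_lt_of_lt_one_left (sub_pos.2 (hab k)) (by linarith)
    simp only [hφ]; linarith
  -- the formula on `[k, k + 1]` (the two definitions agree at the break points)
  have hform : ∀ (k : ℕ) (s : ℝ), (k : ℝ) ≤ s → s ≤ k + 1 → γ s = σ k (φ k s) := by
    intro k s hks hsk
    by_cases hs0 : s ≤ 0
    · have hk : (k : ℝ) = 0 := le_antisymm (hks.trans hs0) (Nat.cast_nonneg k)
      have hk0 : k = 0 := by exact_mod_cast hk
      subst hk0
      have hs : s = 0 := le_antisymm hs0 (by simpa using hks)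
      subst hs
      have : φ 0 0 = a 0 := by simpa using hφa 0
      simp only [hγ, le_refl, if_true, this, hσa]
    · simp only [hγ, if_neg hs0]
      rcases eq_or_lt_of_le hsk with h1 | h1
      · have hfl : ⌊s⌋₊ = k + 1 := by
          rw [h1, show (k : ℝ) + 1 = ((k + 1 : ℕ) : ℝ) by push_cast; ring, Nat.floor_natCast]
        rw [hfl, h1, hφb, hσb, show (k : ℝ) + 1 = ((k + 1 : ℕ) : ℝ) by push_cast; ring, hφa, hσa]
      · have hfl : ⌊s⌋₊ = k := (Nat.floor_eq_iff (not_le.1 hs0).le).2 ⟨hks, h1⟩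
        rw [hfl]
  -- continuity, interval by interval
  have hσc : ∀ k, ContinuousOn (σ k) (Icc (a k) (b k)) := fun k t ht ↦
    ((hσ k).isFutureCausalCurveOn.continuousAt ht).continuousWithinAt
  have hpiece : ∀ k : ℕ, ContinuousOn γ (Icc (k : ℝ) (k + 1)) := fun k ↦ by
    have hφc : Continuous (φ k) := by simp only [hφ]; fun_prop
    have hc : ContinuousOn (fun s ↦ σ k (φ k s)) (Icc (k : ℝ) (k + 1)) :=
      (hσc k).comp hφc.continuousOn fun s hs ↦ hφmem k s hs.1 hs.2
    exact hc.congr fun s hs ↦ hform k s hs.1 hs.2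
  have hIic : ∀ N : ℕ, ContinuousOn γ (Iic (N : ℝ)) := by
    intro N
    induction N with
    | zero =>
      refine (continuousOn_const (c := p 0)).congr fun s hs ↦ ?_
      have hs' : s ≤ 0 := by simpa using hs
      simp only [hγ, if_pos hs']
    | succ N ih =>
      push_cast
      rw [← Iic_union_Icc_eq_Iic (by linarith : (N : ℝ) ≤ N + 1)]
      exact ih.union_of_isClosed (hpiece N) isClosed_Iic isClosed_Icc
  have hcont : Continuous γ := continuous_iff_continuousAt.2 fun s ↦
    (hIic (⌈s⌉₊ + 1)).continuousAt (Iic_mem_nhds (by push_cast; linarith [Nat.le_ceil s]))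
  refine ⟨γ, hcont, fun s hs ↦ by simp only [hγ, if_pos hs], fun s hs0 ↦ ?_⟩
  have hks : (⌊s⌋₊ : ℝ) ≤ s := Nat.floor_le hs0
  have hsk : s < ⌊s⌋₊ + 1 := Nat.lt_floor_add_one s
  have hu : φ ⌊s⌋₊ s ∈ Icc (a ⌊s⌋₊) (b ⌊s⌋₊) := hφmem _ s hks hsk.le
  have hub : φ ⌊s⌋₊ s < b ⌊s⌋₊ := hφlt _ s hsk
  have hγs : γ s = σ ⌊s⌋₊ (φ ⌊s⌋₊ s) := hform _ s hks hsk.le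
  refine ⟨?_, ⟨γ s, rfl, σ ⌊s⌋₊, φ ⌊s⌋₊ s, b ⌊s⌋₊, hub, (hσ _).mono (Icc_subset_Icc_left hu.1),
    hγs.symm, hσb _⟩⟩
  rcases eq_or_lt_of_le hu.1 with h1 | h1
  · exact Or.inl (by rw [hγs, ← h1, hσa])
  · exact Or.inr ⟨p ⌊s⌋₊, rfl, σ ⌊s⌋₊, a ⌊s⌋₊, φ ⌊s⌋₊ s, h1,
      (hσ _).mono (Icc_subset_Icc_right hu.2), hσa _, hγs.symm⟩

variable [BoundarylessManifold I M]

/-- `x ∈ J⁺(S)` and `x ≪ y` imply `y ∈ J⁺(S)` (`I⁺ ⊆ J⁺` and `J⁺J⁺ = J⁺` on manifolds without boundary, `C²`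
metric). O'Neill 1983, Ch. 14, p. 402. [cite: ONeillSemiRiemannian1983, Ch. 14, p. 402] -/
theorem mem_causalFuture_of_mem_causalFuture_of_mem_chronologicalFuture (hn : 2 ≤ n) {S : Set M}
    {x y : M} (hx : x ∈ g.causalFuture τ S) (hy : y ∈ g.chronologicalFuture τ {x}) :
    y ∈ g.causalFuture τ S := by
  have h := LorentzianMetric.causalFuture_mono (singleton_subset_iff.2 hx)
    (LorentzianMetric.chronologicalFuture_subset_causalFuture g τ _ hy)
  rwa [LorentzianMetric.causalFuture_causalFuture_eq hn] at h

/-- `x ≪ y` and `y ∈ J⁻(S)` imply `x ∈ J⁻(S)` (indeed `x ∈ I⁻(S)`: `y ≤ z ∈ S` and push-up `x ≪ y ≤ z ⇒ x ≪ z`,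
O'Neill 1983, Ch. 14, Cor. 14.1). [cite: ONeillSemiRiemannian1983, Ch. 14, Cor. 14.1 (p. 402)] -/
theorem mem_causalPast_of_mem_chronologicalFuture_of_mem_causalPast [FiniteDimensional ℝ E] (hn : 1 ≤ n) {S : Set M}
    {x y : M} (hxy : y ∈ g.chronologicalFuture τ {x}) (hy : y ∈ g.causalPast τ S) :
    x ∈ g.causalPast τ S := by
  rw [LorentzianMetric.causalPast, LorentzianMetric.causalFuture_eq_biUnion] at hy ⊢
  simp only [mem_iUnion, exists_prop] at hy ⊢
  obtain ⟨z, hzS, hyz⟩ := hy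
  have hz : z ∈ g.causalFuture τ {y} := LorentzianMetric.mem_causalPast_singleton_iff.1 hyz
  have hxz : z ∈ g.chronologicalFuture τ {x} :=
    LorentzianMetric.mem_chronologicalFuture_of_mem_chronologicalFuture_of_mem_causalFuture_set hn hxy hz
  exact ⟨z, hzS, LorentzianMetric.chronologicalFuture_subset_causalFuture g τ.reverse _
    (LorentzianMetric.mem_chronologicalPast_of_mem_chronologicalFuture hxz)⟩

end Chain

/-! ### §2 Future-complete normalised null rays of a vacuum Cauchy development are escaping causal curves -/

section Development

variable {X : Type} [TopologicalSpace X] [ChartedSpace E3 X] [IsManifold (𝓡 3) ∞ X]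
  [ConnectedSpace X] {D : InitialDataSet (𝓡 3) X}

/-- `1 ≤ ∞` in `ℕ∞ω` (regularity side condition of the causality theorems). [folklore] -/
private lemma one_le_infty : (1 : ℕ∞ω) ≤ (∞ : ℕ∞ω) := WithTop.coe_le_coe.mpr le_top

/-- `2 ≤ ∞` in `ℕ∞ω` (regularity side condition of the causality theorems). [folklore] -/
private lemma two_le_infty : (2 : ℕ∞ω) ≤ (∞ : ℕ∞ω) := WithTop.coe_le_coe.mpr le_top

/-- The affine domain of a future-complete normalised null ray contains `[0, ∞)` (it is an interval containing `0`
and unbounded above). [folklore] -/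
theorem nullRay_mem_dom (𝒟 : VacuumCauchyDevelopment D) [𝒟.metric.HasLeviCivita] {p : X}
    {γ₀ : ℝ → 𝒟.carrier} {dom : Set ℝ}
    (hray : 𝒟.metric.IsNormalisedNullRayFrom 𝒟.timeOrientation 𝒟.embed 𝒟.normal p γ₀ dom)
    (hunb : ¬ BddAbove dom) {t : ℝ} (ht : 0 ≤ t) : t ∈ dom := by
  obtain ⟨d, hd, htd⟩ := not_bddAbove_iff.1 hunb t
  exact hray.1.2.1.out hray.zero_mem hd ⟨ht, htd.le⟩

/-- **A normalised null ray is a future causal curve on its whole affine domain**: the null, future-directed initial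
velocity propagates along the geodesic (`IsGeodesicOn.isNull_and_isFutureDirected_velocity`; O'Neill 1983, Ch. 3,
p. 69 and Ch. 5, Lemma 5.26). [cite: ONeillSemiRiemannian1983, Ch. 5, Lemma 5.26 (p. 141)] -/
theorem nullRay_isNull_and_isFutureCausalCurveOn (𝒟 : VacuumCauchyDevelopment D) [𝒟.metric.HasLeviCivita]
    {p : X} {γ₀ : ℝ → 𝒟.carrier} {dom : Set ℝ}
    (hray : 𝒟.metric.IsNormalisedNullRayFrom 𝒟.timeOrientation 𝒟.embed 𝒟.normal p γ₀ dom) :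
    (∀ t ∈ dom, 𝒟.metric.IsNull (velocity (𝓡 4) γ₀ t)) ∧
      𝒟.metric.IsFutureCausalCurveOn 𝒟.timeOrientation γ₀ dom := by
  haveI : CovariantDerivative.ContMDiffCovariantDerivative 𝒟.metric.leviCivita 1 :=
    ⟨𝒟.metric.isLocallyContMDiff_leviCivita_holds 1 (by exact_mod_cast le_top) univ isOpen_univ⟩
  obtain ⟨hmax, h0, -, hnull0, hfut0, -⟩ := hray
  have hnf : ∀ t ∈ dom, 𝒟.metric.IsNull (velocity (𝓡 4) γ₀ t) ∧
      𝒟.timeOrientation.IsFutureDirected (velocity (𝓡 4) γ₀ t) := fun t ht ↦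
    IsGeodesicOn.isNull_and_isFutureDirected_velocity 𝒟.metric 𝒟.timeOrientation hmax.isOpen hmax.2.1
      hmax.isGeodesicOn h0 hnull0 hfut0 ht
  exact ⟨fun t ht ↦ (hnf t ht).1, fun t ht ↦
    ⟨IsGeodesicOn.mdifferentiableAt_holds hmax.isGeodesicOn ht, (hnf t ht).2⟩⟩

/-- Along a future-complete normalised null ray, later points are in the causal future of earlier ones:
`γ₀ t' ∈ J⁺(γ₀ t)` for `0 ≤ t ≤ t'`. [cite: ONeillSemiRiemannian1983, Ch. 14, p. 402] -/
theorem nullRay_apply_mem_causalFuture_apply (𝒟 : VacuumCauchyDevelopment D) [𝒟.metric.HasLeviCivita]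
    {p : X} {γ₀ : ℝ → 𝒟.carrier} {dom : Set ℝ}
    (hray : 𝒟.metric.IsNormalisedNullRayFrom 𝒟.timeOrientation 𝒟.embed 𝒟.normal p γ₀ dom)
    (hunb : ¬ BddAbove dom) {t t' : ℝ} (ht : 0 ≤ t) (htt' : t ≤ t') :
    γ₀ t' ∈ 𝒟.metric.causalFuture 𝒟.timeOrientation {γ₀ t} :=
  ((nullRay_isNull_and_isFutureCausalCurveOn 𝒟 hray).2.mono (hray.1.2.1.out (nullRay_mem_dom 𝒟 hray hunb ht)
    (nullRay_mem_dom 𝒟 hray hunb (ht.trans htt')))).apply_right_mem_causalFuture_apply (left_mem_Icc.2 htt')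

/-- The future half of a future-complete normalised null ray from the Cauchy hypersurface lies in `J⁺(ι X)`.
[cite: ONeillSemiRiemannian1983, Ch. 14, p. 402] -/
theorem nullRay_apply_mem_causalFuture_range (𝒟 : VacuumCauchyDevelopment D) [𝒟.metric.HasLeviCivita]
    {p : X} {γ₀ : ℝ → 𝒟.carrier} {dom : Set ℝ}
    (hray : 𝒟.metric.IsNormalisedNullRayFrom 𝒟.timeOrientation 𝒟.embed 𝒟.normal p γ₀ dom)
    (hunb : ¬ BddAbove dom) {t : ℝ} (ht : 0 ≤ t) :
    γ₀ t ∈ 𝒟.metric.causalFuture 𝒟.timeOrientation (range 𝒟.embed) := by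
  have h1 := nullRay_apply_mem_causalFuture_apply 𝒟 hray hunb le_rfl ht
  rw [hray.apply_zero] at h1
  exact LorentzianMetric.causalFuture_mono (singleton_subset_iff.2 (mem_range_self p)) h1

/-- **A future-complete normalised null ray eventually leaves the causal past of every compact set, never to
return.** For compact `K`, `J⁻(K) ∩ J⁺(ι X)` is compact in the Cauchy development (Hawking–Ellis 1973,
Prop. 6.6.6; `TrappedSet.isCompact_causalPast_inter_causalFuture_range_of_isCompact`), the development is globally
hyperbolic (O'Neill 1983, Cor. 14.39), and a null geodesic ray is not partially imprisoned in a compact set of a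
globally hyperbolic spacetime (O'Neill 1983, Ch. 14, Lemma 14.13; `Spacetime.exists_forall_notMem_of_isGeodesicOn_of_isNull`);
the future half of the ray lies in `J⁺(ι X)`. [cite: ONeillSemiRiemannian1983, Ch. 14, Lemma 13 (p. 407)] -/
theorem nullRay_exists_forall_not_mem_causalPast (𝒟 : VacuumCauchyDevelopment D) [𝒟.metric.HasLeviCivita]
    {p : X} {γ₀ : ℝ → 𝒟.carrier} {dom : Set ℝ}
    (hray : 𝒟.metric.IsNormalisedNullRayFrom 𝒟.timeOrientation 𝒟.embed 𝒟.normal p γ₀ dom)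
    (hunb : ¬ BddAbove dom) {K : Set 𝒟.carrier} (hK : IsCompact K) :
    ∃ s₀ : ℝ, 0 ≤ s₀ ∧ ∀ s : ℝ, s₀ ≤ s → γ₀ s ∉ 𝒟.metric.causalPast 𝒟.timeOrientation K := by
  obtain ⟨hnull, hcausal⟩ := nullRay_isNull_and_isFutureCausalCurveOn 𝒟 hray
  have hK' := TrappedSet.isCompact_causalPast_inter_causalFuture_range_of_isCompact 𝒟.toCauchyDevelopment hK
  obtain ⟨s₀, hs₀, hout⟩ := 𝒟.toSpacetime.exists_forall_notMem_of_isGeodesicOn_of_isNull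
    𝒟.toCauchyDevelopment.isGloballyHyperbolic
    (hray.1.isGeodesicOn.mono fun t ht ↦ nullRay_mem_dom 𝒟 hray hunb ht)
    (fun s hs ↦ hnull s (nullRay_mem_dom 𝒟 hray hunb hs)) hK'
  exact ⟨s₀, hs₀, fun s hs hsK ↦ hout s hs ⟨hsK, nullRay_apply_mem_causalFuture_range 𝒟 hray hunb (hs₀.trans hs)⟩⟩

/-! ### §3–§4 The chain below the ray and the escaping path -/

/-- **Every outer point lies on a continuous future-escaping outer path** (the causal bookkeeping (4) of
`stub_exhaustionFromKerrAsymptotics`): for `q ∈ outerRegion 𝒟` there is a continuous `γ : ℝ → 𝒟` with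
`IsFutureEscapingPath 𝒟 γ` and `γ 0 = q`. See the module docstring for the construction (a `≪`-chain threaded
below a future-complete null ray, pushed out of the causal pasts of a compact exhaustion). O'Neill 1983, Ch. 14,
Cor. 14.1, Lemma 14.6, Lemma 14.13, Lemma 14.22, Lemma 14.40. [cite: ONeillSemiRiemannian1983, Ch. 14, Cor. 14.1 (p. 402) and Lemma 14.6 (p. 404)] -/
theorem exists_isFutureEscapingPath (𝒟 : VacuumCauchyDevelopment D) [𝒟.metric.HasLeviCivita]
    {q : 𝒟.carrier} (hq : q ∈ outerRegion 𝒟) :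
    ∃ γ : ℝ → 𝒟.carrier, Continuous γ ∧ IsFutureEscapingPath 𝒟 γ ∧ γ 0 = q := by
  classical
  haveI : LocallyCompactSpace 𝒟.carrier := Manifold.locallyCompact_of_finiteDimensional (M := 𝒟.carrier) (𝓡 4)
  set K_ : CompactExhaustion 𝒟.carrier := CompactExhaustion.choice 𝒟.carrier with hK_
  set g := 𝒟.metric with hg
  set τ := 𝒟.timeOrientation with hτ
  obtain ⟨hqJ, p, γ₀, dom, hray, hunb, hqI⟩ := hq
  -- `q ≪ γ₀ t₁` for some `t₁ ∈ dom`, `t₁ ≥ 0`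
  have hqI' := hqI
  rw [LorentzianMetric.chronologicalPast, LorentzianMetric.chronologicalFuture_eq_biUnion, mem_iUnion₂] at hqI'
  obtain ⟨_, ⟨t₁, ⟨-, ht₁⟩, rfl⟩, hqx⟩ := hqI'
  replace ht₁ : 0 ≤ t₁ := ht₁
  have hqr : γ₀ t₁ ∈ g.chronologicalFuture τ {q} :=
    LorentzianMetric.mem_chronologicalFuture_of_mem_chronologicalPast hqx
  -- pushing `≪` up the ray
  have hrr : ∀ {t t' : ℝ}, 0 ≤ t → t ≤ t' → γ₀ t' ∈ g.causalFuture τ {γ₀ t} := fun ht htt' ↦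
    nullRay_apply_mem_causalFuture_apply 𝒟 hray hunb ht htt'
  have hpush : ∀ {x y z : 𝒟.carrier}, y ∈ g.chronologicalFuture τ {x} → z ∈ g.causalFuture τ {y} →
      z ∈ g.chronologicalFuture τ {x} := fun hxy hyz ↦
    LorentzianMetric.mem_chronologicalFuture_of_mem_chronologicalFuture_of_mem_causalFuture_set
      one_le_infty hxy hyz
  -- §3 the chain step
  have hstep : ∀ (k : ℕ) (x : 𝒟.carrier), (∃ m : ℕ, γ₀ (t₁ + m) ∈ g.chronologicalFuture τ {x}) →
      ∃ y : 𝒟.carrier, y ∈ g.chronologicalFuture τ {x} ∧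
        (∃ m : ℕ, γ₀ (t₁ + m) ∈ g.chronologicalFuture τ {y}) ∧ y ∉ g.causalPast τ (K_ (k + 1)) := by
    rintro k x ⟨m, hm⟩
    obtain ⟨s₀, hs₀, hout⟩ := nullRay_exists_forall_not_mem_causalPast 𝒟 hray hunb (K_.isCompact (k + 1))
    obtain ⟨m₁, hmm₁, hsm₁⟩ : ∃ m₁ : ℕ, m ≤ m₁ ∧ s₀ ≤ t₁ + m₁ := by
      refine ⟨max m ⌈s₀⌉₊, le_max_left _ _, ?_⟩
      have h1 : s₀ ≤ (⌈s₀⌉₊ : ℝ) := Nat.le_ceil s₀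
      have h2 : ((⌈s₀⌉₊ : ℕ) : ℝ) ≤ ((max m ⌈s₀⌉₊ : ℕ) : ℝ) := by exact_mod_cast le_max_right _ _
      linarith
    have hxm₁ : γ₀ (t₁ + m₁) ∈ g.chronologicalFuture τ {x} :=
      hpush hm (hrr (by positivity) (by gcongr))
    have hout₁ : γ₀ (t₁ + m₁) ∉ g.causalPast τ (K_ (k + 1)) := hout _ hsm₁
    have hU : IsOpen (g.chronologicalFuture τ {x} ∩ (g.causalPast τ (K_ (k + 1)))ᶜ) :=
      (LorentzianMetric.isOpen_chronologicalFuture_of_boundaryless g τ _).inter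
        (𝒟.toCauchyDevelopment.isGloballyHyperbolic.reverse.isClosed_causalFuture_of_isCompact two_le_infty
          (K_.isCompact (k + 1))).isOpen_compl
    have hcl : γ₀ (t₁ + m₁) ∈ closure (g.chronologicalPast τ {γ₀ (t₁ + m₁ + 1)}) := by
      have h1 : γ₀ (t₁ + m₁ + 1) ∈ g.causalFuture τ {γ₀ (t₁ + m₁)} := hrr (by positivity) (by linarith)
      exact LorentzianMetric.causalFuture_subset_closure_chronologicalFuture_of_boundaryless (τ := τ.reverse)
        one_le_infty _ (LorentzianMetric.mem_causalPast_singleton_iff.2 h1)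
    obtain ⟨y, ⟨hyx, hyK⟩, hy⟩ := mem_closure_iff.1 hcl _ hU ⟨hxm₁, hout₁⟩
    refine ⟨y, hyx, ⟨m₁ + 1, ?_⟩, hyK⟩
    have h2 := LorentzianMetric.mem_chronologicalFuture_of_mem_chronologicalPast hy
    push_cast
    rwa [← add_assoc]
  -- §3 the chain `q = p₀ ≪ p₁ ≪ ⋯`
  choose! F hFx hFm hFK using hstep
  set pt : ℕ → 𝒟.carrier := fun k ↦ Nat.rec q (fun k x ↦ F k x) k with hpt
  have hpt0 : pt 0 = q := rfl
  have hpts : ∀ k, pt (k + 1) = F k (pt k) := fun k ↦ rfl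
  have hinv : ∀ k, ∃ m : ℕ, γ₀ (t₁ + m) ∈ g.chronologicalFuture τ {pt k} := by
    intro k
    induction k with
    | zero => refine ⟨0, ?_⟩; rw [hpt0]; simpa using hqr
    | succ k ih => rw [hpts]; exact hFm k _ ih
  have hchain : ∀ k, pt (k + 1) ∈ g.chronologicalFuture τ {pt k} := fun k ↦ by
    rw [hpts]; exact hFx k _ (hinv k)
  have hesc : ∀ k, pt (k + 1) ∉ g.causalPast τ (K_ (k + 1)) := fun k ↦ by
    rw [hpts]; exact hFK k _ (hinv k)
  have hJ : ∀ k, pt k ∈ g.causalFuture τ (range 𝒟.embed) := by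
    intro k
    induction k with
    | zero => exact hqJ
    | succ k ih =>
      exact mem_causalFuture_of_mem_causalFuture_of_mem_chronologicalFuture two_le_infty ih (hchain k)
  -- §4 the path
  obtain ⟨γ, hγc, hγ0, hγs⟩ := exists_continuous_of_chronologicalChain hchain
  refine ⟨γ, hγc, ⟨fun s ↦ ?_, fun K hK ↦ ?_⟩, (hγ0 0 le_rfl).trans hpt0⟩
  · -- outer
    rcases le_or_gt s 0 with hs | hs
    · rw [hγ0 s hs]
      exact ⟨hqJ, p, γ₀, dom, hray, hunb, hqI⟩
    · obtain ⟨h1, h2⟩ := hγs s hs.le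
      refine ⟨?_, p, γ₀, dom, hray, hunb, ?_⟩
      · rcases h1 with h1 | h1
        · rw [h1]; exact hJ _
        · exact mem_causalFuture_of_mem_causalFuture_of_mem_chronologicalFuture two_le_infty (hJ _) h1
      · obtain ⟨m, hm⟩ := hinv (⌊s⌋₊ + 1)
        have h0 : (0 : ℝ) ≤ t₁ + m := by positivity
        have h3 : γ₀ (t₁ + m) ∈ g.chronologicalFuture τ {γ s} := LorentzianMetric.mem_chronologicalFuture_trans h2 hm
        have h4 : γ₀ (t₁ + m) ∈ γ₀ '' (dom ∩ Ici 0) := mem_image_of_mem γ₀ ⟨nullRay_mem_dom 𝒟 hray hunb h0, h0⟩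
        exact LorentzianMetric.chronologicalFuture_mono (τ := τ.reverse) (singleton_subset_iff.2 h4)
          (LorentzianMetric.mem_chronologicalPast_of_mem_chronologicalFuture h3)
  · -- escaping
    obtain ⟨N, hN⟩ := K_.exists_superset_of_isCompact hK
    refine Filter.eventually_atTop.2 ⟨(N : ℝ) + 1, fun s hs hsK ↦ ?_⟩
    have hs0 : (0 : ℝ) ≤ s := le_trans (by positivity) hs
    obtain ⟨h1, -⟩ := hγs s hs0
    have hNk : N + 1 ≤ ⌊s⌋₊ := Nat.le_floor (by push_cast; exact hs)
    have hk1 : 1 ≤ ⌊s⌋₊ := le_trans (Nat.le_add_left 1 N) hNk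
    have hpk : pt ⌊s⌋₊ ∉ g.causalPast τ (K_ ⌊s⌋₊) := by
      have h := hesc (⌊s⌋₊ - 1)
      rwa [Nat.sub_add_cancel hk1] at h
    have hsub : g.causalPast τ K ⊆ g.causalPast τ (K_ ⌊s⌋₊) :=
      LorentzianMetric.causalFuture_mono (τ := τ.reverse) (hN.trans (K_.subset (by omega)))
    refine hpk (hsub ?_)
    rcases h1 with h1 | h1
    · rwa [h1] at hsK
    · exact mem_causalPast_of_mem_chronologicalFuture_of_mem_causalPast one_le_infty h1 hsK

/-- **Registered sub-goal `stub_exists_futureEscapingPath` of `stub_exhaustionFromKerrAsymptotics` (S6), line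
`kerr-isolation-dichotomy`: late observers exist.** In every vacuum Cauchy development, every point of the outer
region `J⁺(ι X) ∩ ⋃ I⁻(future half of a future-complete normalised null ray from ι X)` is the starting point `γ 0` of a
CONTINUOUS FUTURE-ESCAPING OUTER PATH `γ : ℝ → 𝒟` (`TameHull.IsFutureEscapingPath`: every `γ s` outer, and `γ`
eventually leaves `J⁻(K)` for every compact `K`). No maximality, completeness of `𝓘⁺` or tameness is used
(`exists_isFutureEscapingPath`). [cite: ONeillSemiRiemannian1983, Ch. 14, Cor. 14.1 (p. 402) and Lemma 14.6 (p. 404)] -/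
theorem stub_exists_futureEscapingPath : ∀ (X : Type) [TopologicalSpace X] [ChartedSpace E3 X] [IsManifold (𝓡 3) ∞ X] [T2Space X] [SecondCountableTopology X] [ConnectedSpace X] (D : InitialDataSet (𝓡 3) X) (𝒟 : VacuumCauchyDevelopment D) [𝒟.metric.HasLeviCivita], ∀ q ∈ outerRegion 𝒟, ∃ γ : ℝ → 𝒟.carrier, Continuous γ ∧ IsFutureEscapingPath 𝒟 γ ∧ γ 0 = q :=
  fun _ _ _ _ _ _ _ _ 𝒟 _ _ hq ↦ exists_isFutureEscapingPath 𝒟 hq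

end Development

end Summit.FinalStateConjecture.FinalStateConjecture.Theorems

end
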